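import Summits.HodgeConjecture.HodgeConjecture.Theorems.F0P3cStCharTSWeylHypCM           -- ★ p849636 (B0) LH2-p01 (g3): `centralizer_eq_cmTorus_of_isRegularElt`, `mem_normalizer_cmTorus_iff_of_nonsplit`, `isUnit_of_ne_zero_of_nonsplit`, `exists_mem_torusU_isRegularElt`
import Summits.HodgeConjecture.HodgeConjecture.Theorems.F0P3cStCharTSWeylHypTorsor       -- ★ p849633 (B1) LH1-p01 (g3): `conj_mem_hypSet`, `isRegularElt_of_mem_hypSet`, `mem_hypSet_of_mem_torusU`, Weyl element lemmas
import Literature.MeasureTheory.Group.ConjugationWeylVanishing                             -- ★ `exists_radialMeasure_lintegral_conjFamily` (Jacobian-free Weyl formula, radial form)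
import Literature.NumberTheory.Automorphic.UnitaryGroupTorusOrbitalDescentNonsplit         -- ★ `mul_comm_of_mem_torusU_cmLocal`, ★ `isClosed_cmBorelTriple_M`
import Literature.NumberTheory.Automorphic.CMTorusRegularAEPrelims                         -- ★ `continuous_coe_torusEntry_apply`
import Literature.NumberTheory.Automorphic.LocalUnitaryGroupCongrMeasure                   -- ★ `locallyCompactSpace_local`, `secondCountableTopology_local`, `t2Space_cmDatum_local`
import HarnessLib

/-!
# F0 · P3c · line LH6 «StCharTS» — «WEYL-HYP★» STAGE (B): THE WEYL INTEGRATION FORMULA ON THE HYPERBOLIC SET OF `U(Φ₃)(L⁺_v)`,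
# RADIAL FORM, UNCONDITIONAL (Harish-Chandra 1970 Lemma 42 ∕ Weil 1965 n° 49 ∕ Federer §2.10.10, instantiated; Rogawski 1990 §12.5 p. 182)

Cell `pub/hodgecm-mathlib`, crux H413 = `stmt-HodgeConjecture-24833` (lane `--supports`, helper; route HCCMUnconditional); seat LH2-p02 (g3), deal
«WEYL-HYP★ STAGE (B) — THE MEASURE IDENTITY» (desk heir F0P3-plan (g14) 2026-09-02T05:48:05Z on F0P3b-plan (g23)'s 05:26:46Z stage text «(B) the measure
identity `∫_Ω φ dg = ½ ∫_{M^{reg}} |D_G(m)| ∫_{G∕M} φ(g m g⁻¹) dġ dm`»).  Sequel of ★ p849559∕p849560 (A0)–(A3) (LH2-p01 (g3)), ★ p849633 (B1) (LH1-p01 (g3)),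
★ p849636 (B0) (LH2-p01 (g3)).  THEOREMS ONLY; sorry-free; no definition ∕ instance ∕ notation ∕ named fact; axioms TRIO.

THE POINT (census of this seat).  The tree ALREADY holds the Jacobian-free half of the Weyl integration formula: ★
`Literature/MeasureTheory/Group/ConjugationWeylVanishing.lean` :: `exists_radialMeasure_lintegral_conjFamily` [HarishChandra1970 L. 42; Weil1965 n° 49 L. 22;
Federer1969 §2.10.10] — for a closed abelian `T ≤ G` with finite Weyl group and a conjugation-invariant Borel «regular» set on which centralisers of elements of
`T` are exactly `T`, there is a RADIAL measure `σ` on `T` with `|W| ∫⁻_{Φ(D)} f dν = ∫⁻_T ∫⁻_{G⧸T} f(x t x⁻¹) d(ν∕tm) dσ(t)` (fibre-count pull-back + Weil's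
relative uniqueness; NO openness, NO submersion, NO Jacobian).  This file INSTANTIATES it at `G = U(Φ₃)(L⁺_v)` (the matrix carrier
`↥(unitaryGroupOfForm (conjLocal L c v) (cmLocalForm L 3 v))`, `rfl`-equal to `Gqs L v`), `T = (cmBorelTriple L 3 v).M` the split diagonal torus, at a NON-SPLIT
finite place `v`, discharging every hypothesis BY NAME, and transports the result to Bochner integrals.

* §1 (generic, `[CommRing R]`, any `σ J N` unless said) **`exists_conjFamily`** — the ★ idiom's parameter `Φ : (G ⧸ T) × T → G`, `Φ(xT, t) = x t x⁻¹`, EXISTS for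
  `T` abelian (any group); **`isRegularElt_glDiagonal_of_isUnit_sub`** (converse of ★ (A0′)); **`isRegularElt_coe_torusU_iff`** (`R` field-like: `t ∈ T` is regular
  iff its diagonal entries are pairwise distinct); **`isOpen_setOf_isRegularElt_torusU`** (`T^{reg}` is open in `T`, `R` a `T₁` topological ring);
  **`index_torusU_subgroupOf_normalizer_eq_two`** — `|N(T)∕T| = 2` for `J = Φ₃`, `R` field-like (★ (A2) + the Weyl element of ★ (B1), `Subgroup.index_eq_two_iff`).
* §2 (generic measure theory, Mathlib only) **`map_prod_eq_smul_restrict_of_lintegral_radial`** — a radial `∫⁻` identity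
  `w · ∫⁻_Ω f dν = ∫⁻_S ∫⁻_Q f(Ψ(q,t)) dμ₀ dσ` (all Borel `f ≥ 0`) IS the identity of measures `(σ ⊗ μ₀) ∘ Ψ̃⁻¹ = w · ν|_Ω`; hence
  **`integrable_and_integral_eq_smul_of_lintegral_radial`** — the same identity for BOCHNER integrals of any `g` that is `ν`-integrable on `Ω`
  (`∫_S ∫_Q g(Ψ(q,t)) dμ₀ dσ = w • ∫_Ω g dν`, with integrability of the pulled-back integrand).
* §3 (CM, `v` non-split) **`exists_radialMeasure_lintegral_hypSet`** — THE RADIAL WEYL INTEGRATION FORMULA ON THE HYPERBOLIC SET `Ω = ⋃_g g T^{reg} g⁻¹`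
  (★ (B1)'s token shape): a measure `σ` on `T`, finite on compact sets, σ-finite, carried by `T^{reg}`, with **`2 · ∫⁻_Ω f dν = ∫⁻_T ∫⁻_{G⧸T} f(Φ(q, t)) d(ν∕tm) dσ(t)`**
  for every Borel `f ≥ 0` (`ν∕tm` = ★ `quotientMeasure`); **`exists_radialMeasure_integral_hypSet`** — the same `σ` with the measure form `(σ ⊗ (ν∕tm)) ∘ Φ̃⁻¹ = 2 · ν|_Ω`
  and the ℂ-valued Bochner form `∫_T ∫_{G⧸T} g(Φ(q,t)) = 2 • ∫_Ω g dν` (`g` ν-integrable on `Ω`; the currency of ★ van Dijk ∕ (PSM★)).  Ingredients: ★ `isClosed_cmBorelTriple_M`,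
  ★ `mul_comm_of_mem_torusU_cmLocal`, ★ (B0) `centralizer_eq_cmTorus_of_isRegularElt`, `|W| = 2` (§1 over ★ (B0)'s `hR`∕`hex`, ★ `cmLocalForm_eq_over`), local injectivity
  ★ `exists_isOpen_injOn_conjFamily`, `Ω = Φ(G⧸T × T^{reg})` Borel by Lusin–Souslin (★ `measurableSet_image_inter_of_locallyInjOn`; `T^{reg}` open, §1), then ★
  `exists_radialMeasure_lintegral_conjFamily` with «regular set» `R := Ω` (★ (B1) `conj_mem_hypSet`, `mem_hypSet_of_mem_torusU`, `isRegularElt_of_mem_hypSet`).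

WHAT IS NOT HERE (honest): the identification of the radial measure, classically `dσ = |D_G(t)| dt` (van Dijk's weight = LH2-p01's (B2) `WeylDiscriminant`
∕ LH6-p01's `wt` token) — the ONE analytic input of the Weyl integration formula (the Jacobian of the conjugation map, [HarishChandra1970, Lemma 22],
[vanDijk1972, §2]); it is absent from the tree (★ `PadicPolynomialChangeOfVariables` treats polynomial maps of `ℤ_pⁿ`, not group charts) and is the subject of the
follow-up «(B-jac)».  Note that `σ` is determined by the displayed identity only up to W-symmetrisation (`t ↦ O_t(f)` is `W`-invariant).

HONEST LABEL: count-neutral (TOR)-road measure theory for the LH6 leaf; closes no organ.  HC_CM is proved only modulo the 7 printed citations (2 remaining: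
hLiu418 = `stmt-HodgeConjecture-24832`, h413 = `stmt-HodgeConjecture-24833`) until rung 0 closes.

## References
* [Rogawski1990] J. D. Rogawski, *Automorphic Representations of Unitary Groups in Three Variables*, Ann. of Math. Stud. 123 (1990), §12.5 p. 182 (Weyl
  integration on the split torus `M`, the factor `½`), §1.10 p. 9, §3.1 p. 19.
* [HarishChandra1970] Harish-Chandra, *Harmonic analysis on reductive p-adic groups*, LNM 162 (1970), Lemma 42 (and Lemma 22 for the Jacobian).
* [vanDijk1972] G. van Dijk, *Computation of certain induced characters of p-adic groups*, Math. Ann. 199 (1972) 229–240, §2.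
* [Weil1965] A. Weil, *Sur la formule de Siegel dans la théorie des groupes classiques*, Acta Math. 113 (1965), n° 49 Lemme 22 (p. 70).
* [Federer1969] H. Federer, *Geometric Measure Theory* (1969), §2.10.10.
-/

set_option autoImplicit false
set_option linter.dupNamespace false

noncomputable section

open MeasureTheory Measure Set Filter Topology Function NumberField IsDedekindDomain Matrix Polynomial
open Literature.MeasureTheory.Group
open Literature.NumberTheory.Automorphic Literature.NumberTheory.Automorphic.UnitaryGroup Literature.NumberTheory.Rogawski1990
open Summit.HodgeConjecture.HodgeConjecture.Cruxes.H413.F0P3cStCharTSWeylHypFibre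
open Summit.HodgeConjecture.HodgeConjecture.Cruxes.H413.F0P3cStCharTSWeylHypNormaliser
open Summit.HodgeConjecture.HodgeConjecture.Cruxes.H413.F0P3cStCharTSWeylHypTorsor
open Summit.HodgeConjecture.HodgeConjecture.Cruxes.H413.F0P3cStCharTSWeylHypCM
open scoped ENNReal NNReal MatrixGroups Pointwise

namespace Summit.HodgeConjecture.HodgeConjecture.Cruxes.H413.F0P3cStCharTSWeylHypMeasure

/-! ## §1 Generic group theory: the conjugation family exists; `|N(T)∕T| = 2` for `U(Φ₃)`; regularity on the torus is open -/

/-- **The conjugation family exists**: for an abelian subgroup `T` of any group `G` there is `Φ : (G ⧸ T) × T → G` with `Φ(xT, t) = x t x⁻¹` (the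
parameter-pinned-by-an-equation idiom of ★ `ConjugationFamilyFibres`; `Φ(q, t) := q.out · t · q.out⁻¹`, independent of the representative since `T` is
abelian). [cite: HarishChandra1970, Lemma 42] -/
theorem exists_conjFamily {G : Type*} [Group G] (T : Subgroup G) (hTc : ∀ a ∈ T, ∀ b ∈ T, a * b = b * a) :
    ∃ Φ : (G ⧸ T) × T → G, ∀ (x : G) (t : T), Φ (QuotientGroup.mk x, t) = x * t * x⁻¹ := by
  refine ⟨fun p => p.1.out * (p.2 : G) * p.1.out⁻¹, fun x t => ?_⟩
  obtain ⟨s, hs⟩ := QuotientGroup.mk_out_eq_mul T x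
  have hst : (s : G) * t = t * s := hTc _ s.2 _ t.2; simp only [hs]
  calc x * s * t * (x * s)⁻¹ = x * (s * t) * ((s : G)⁻¹ * x⁻¹) := by rw [_root_.mul_inv_rev]; group
    _ = x * t * x⁻¹ := by rw [hst]; group

section Torus

variable {R : Type*} [CommRing R] (σ : R →+* R) {N : ℕ} (J : Matrix (Fin N) (Fin N) R)

/-- **Unit differences ⇒ `diag(d)` regular** (converse of ★ (A0′) `isUnit_sub_of_isRegularElt_glDiagonal`; any commutative ring): `∏ (X − C dᵢ)` is separable when the
`X − C dᵢ` are pairwise coprime (Mathlib `isCoprime_X_sub_C_of_isUnit_sub`, `separable_prod'`). [cite: Rogawski1990, §3.1 p. 19] -/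
theorem isRegularElt_glDiagonal_of_isUnit_sub {d : Fin N → Rˣ} (h : ∀ i j : Fin N, i ≠ j → IsUnit ((d i : R) - d j)) :
    IsRegularElt (glDiagonal N R d) := by
  rw [IsRegularElt, coe_glDiagonal, Matrix.charpoly_diagonal]
  exact Polynomial.separable_prod' (fun i _ j _ hij => Polynomial.isCoprime_X_sub_C_of_isUnit_sub (h i j hij))
    (fun i _ => Polynomial.separable_X_sub_C)

/-- **Regularity on the torus, field-like `R`**: `t ∈ T` is regular (separable characteristic polynomial) iff its diagonal entries are pairwise distinct
(`x ≠ 0 ⇒ IsUnit x` turns ★ (A0′)'s unit differences into non-vanishing differences). [cite: Rogawski1990, §3.1 p. 19; §12.5 p. 182] -/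
theorem isRegularElt_coe_torusU_iff [Nontrivial R] (hR : ∀ x : R, x ≠ 0 → IsUnit x) (t : ↥(torusU σ J)) :
    IsRegularElt (((t : ↥(unitaryGroupOfForm σ J)) : GL (Fin N) R)) ↔
      ∀ i j : Fin N, i ≠ j → ((torusEntry σ J i t : Rˣ) : R) - (torusEntry σ J j t : Rˣ) ≠ 0 := by
  obtain ⟨d, hd⟩ := (mem_torusU_iff _).1 t.2
  have hdi : ∀ i, torusEntry σ J i t = d i := fun i => torusEntry_eq_of_glDiagonal_eq σ J i t d hd
  simp only [hdi]
  rw [← hd]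
  constructor
  · intro h i j hij
    exact (isUnit_sub_of_isRegularElt_glDiagonal h hij).ne_zero
  · intro h
    exact isRegularElt_glDiagonal_of_isUnit_sub fun i j hij => hR _ (h i j hij)

/-- **`T^{reg}` is open in `T`** (`R` a `T₁` topological ring, field-like): it is the finite intersection of the open sets `{dᵢ − dⱼ ≠ 0}`, the coordinates being
continuous (★ `continuous_coe_torusEntry_apply`). [cite: Rogawski1990, §12.5 p. 182] [cite: HarishChandra1970, Lemma 42] -/
theorem isOpen_setOf_isRegularElt_torusU [TopologicalSpace R] [IsTopologicalRing R] [T1Space R] [Nontrivial R]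
    (hR : ∀ x : R, x ≠ 0 → IsUnit x) :
    IsOpen {t : ↥(torusU σ J) | IsRegularElt (((t : ↥(unitaryGroupOfForm σ J)) : GL (Fin N) R))} := by
  have hset : {t : ↥(torusU σ J) | IsRegularElt (((t : ↥(unitaryGroupOfForm σ J)) : GL (Fin N) R))} =
      ⋂ i : Fin N, ⋂ j : Fin N, {t : ↥(torusU σ J) | i ≠ j → ((torusEntry σ J i t : Rˣ) : R) - (torusEntry σ J j t : Rˣ) ≠ 0} := by
    ext t
    simp only [mem_setOf_eq, mem_iInter, isRegularElt_coe_torusU_iff σ J hR]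
  rw [hset]
  refine isOpen_iInter_of_finite fun i => isOpen_iInter_of_finite fun j => ?_
  by_cases hij : i = j
  · have : {t : ↥(torusU σ J) | i ≠ j → ((torusEntry σ J i t : Rˣ) : R) - (torusEntry σ J j t : Rˣ) ≠ 0} = univ := by
      ext t; simp [hij]
    rw [this]; exact isOpen_univ
  · have : {t : ↥(torusU σ J) | i ≠ j → ((torusEntry σ J i t : Rˣ) : R) - (torusEntry σ J j t : Rˣ) ≠ 0} =
        (fun t : ↥(torusU σ J) => ((torusEntry σ J i t : Rˣ) : R) - (torusEntry σ J j t : Rˣ)) ⁻¹' {0}ᶜ := by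
      ext t; simp [hij]
    rw [this]
    exact (isOpen_compl_singleton).preimage
      ((continuous_coe_torusEntry_apply σ J i).sub (continuous_coe_torusEntry_apply σ J j))

end Torus

section Index

variable {R : Type*} [CommRing R] (σ : R →+* R) {J : Matrix (Fin 3) (Fin 3) R}

/-- **`|W| = |N(T)∕T| = 2` for `U(Φ₃)`** (`R` non-trivial field-like, `J = Φ₃`, a regular element in `T`): by ★ (A2) `mem_normalizer_torusU_antidiag_three_iff` an
element of `N(T)` is diagonal (∈ `T`) or anti-diagonal (then its product with the Weyl element `w` of ★ (B1) — matrix `Φ₃`, `w ∈ N(T) ∖ T` — lies in `T`), so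
`Subgroup.index_eq_two_iff` applies with `a := w`. [cite: Rogawski1990, §12.5 p. 182] [cite: vanDijk1972, §2] -/
theorem index_torusU_subgroupOf_normalizer_eq_two [Nontrivial R] (hR : ∀ x : R, x ≠ 0 → IsUnit x)
    (hJ : J = (StdForm.antidiagonal 3).over R)
    (hex : ∃ m : ↥(unitaryGroupOfForm σ J), m ∈ torusU σ J ∧ IsRegularElt (m : GL (Fin 3) R)) :
    ((torusU σ J).subgroupOf (Subgroup.normalizer (torusU σ J : Set ↥(unitaryGroupOfForm σ J)))).index = 2 := by
  classical
  set w : ↥(unitaryGroupOfForm σ J) :=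
    ⟨(⟨J, J, by rw [hJ, StdForm.over_mul_over], by rw [hJ, StdForm.over_mul_over]⟩ : GL (Fin 3) R),
      antidiagOne_mem_unitaryGroupOfForm σ hJ⟩ with hwdef
  have hw : ((w : GL (Fin 3) R) : Matrix (Fin 3) (Fin 3) R) = J := rfl
  have hwT := weyl_not_mem_torusU σ hJ hw
  refine Subgroup.index_eq_two_iff.2 ⟨⟨w, weyl_mem_normalizer σ hR hJ hex hw⟩, fun b => ?_⟩
  simp only [Subgroup.mem_subgroupOf, Subgroup.coe_mul]
  rcases (mem_normalizer_torusU_antidiag_three_iff σ hR hJ hex (b : ↥(unitaryGroupOfForm σ J))).1 b.2 with hdiag | hanti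
  · have hbT : (b : ↥(unitaryGroupOfForm σ J)) ∈ torusU σ J := (mem_torusU_iff_forall_apply_eq_zero σ J _).2 hdiag
    refine Or.inr ⟨hbT, fun hbw => hwT ?_⟩
    have := (torusU σ J).mul_mem ((torusU σ J).inv_mem hbT) hbw
    rwa [← mul_assoc, inv_mul_cancel, one_mul] at this
  · have hbw : (b : ↥(unitaryGroupOfForm σ J)) * w ∈ torusU σ J := by
      rw [mem_torusU_iff_forall_apply_eq_zero]
      intro i j hij
      rw [Subgroup.coe_mul, Units.val_mul]
      exact antidiag_mul_antidiag_apply_eq_zero hanti (weyl_apply_eq_zero σ hJ hw) hij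
    refine Or.inl ⟨hbw, fun hbT => hwT ?_⟩
    have := (torusU σ J).mul_mem ((torusU σ J).inv_mem hbT) hbw
    rwa [← mul_assoc, inv_mul_cancel, one_mul] at this

end Index

/-! ## §2 Generic measure theory: a radial `∫⁻` identity is an identity of measures, hence holds for Bochner integrals -/

section Radial

variable {G Q S : Type*} [MeasurableSpace G] [MeasurableSpace Q] [MeasurableSpace S]
  {ν : Measure G} {Ω : Set G} {σ : Measure S} [SigmaFinite σ] {μ₀ : Measure Q} [SigmaFinite μ₀]
  {Ψ : Q × S → G} (hΨ : Measurable Ψ) {w : ℕ}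
  (h : ∀ f : G → ℝ≥0∞, Measurable f → (w : ℝ≥0∞) * ∫⁻ y in Ω, f y ∂ν = ∫⁻ t, ∫⁻ q, f (Ψ (q, t)) ∂μ₀ ∂σ)

omit [SigmaFinite σ] in
include hΨ h in
/-- **A radial `∫⁻` identity is an identity of measures**: if `w · ∫⁻_Ω f dν = ∫⁻_S ∫⁻_Q f(Ψ(q, t)) dμ₀(q) dσ(t)` for every measurable `f ≥ 0`, then the image
of `σ ⊗ μ₀` under `(t, q) ↦ Ψ(q, t)` is `w · ν|_Ω` (test on indicators; Tonelli). [cite: Federer1969, §2.10.10] -/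
theorem map_prod_eq_smul_restrict_of_lintegral_radial :
    (σ.prod μ₀).map (fun p : S × Q => Ψ (p.2, p.1)) = (w : ℝ≥0∞) • ν.restrict Ω := by
  have hΨ' : Measurable (fun p : S × Q => Ψ (p.2, p.1)) := hΨ.comp measurable_swap
  ext A hA
  have hind : (fun p : S × Q => ((fun p : S × Q => Ψ (p.2, p.1)) ⁻¹' A).indicator (1 : S × Q → ℝ≥0∞) p) =
      fun p => A.indicator 1 (Ψ (p.2, p.1)) := by
    funext p
    simp only [Set.indicator, mem_preimage, Pi.one_apply]
    rfl
  have hmeas : Measurable (fun p : S × Q => A.indicator (1 : G → ℝ≥0∞) (Ψ (p.2, p.1))) :=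
    (measurable_one.indicator hA).comp hΨ'
  rw [Measure.map_apply hΨ' hA, Measure.smul_apply, smul_eq_mul, ← lintegral_indicator_one (hΨ' hA), hind,
    lintegral_prod (fun p : S × Q => A.indicator (1 : G → ℝ≥0∞) (Ψ (p.2, p.1))) hmeas.aemeasurable,
    ← lintegral_indicator_one hA]
  exact (h (A.indicator 1) (measurable_one.indicator hA)).symm

include hΨ h in
/-- **Radial `∫⁻` identity ⇒ the same identity for Bochner integrals**: under the hypothesis of `map_prod_eq_smul_restrict_of_lintegral_radial`, every `g : G → E`
that is `ν`-integrable on `Ω` has `(t, q) ↦ g(Ψ(q, t))` integrable for `σ ⊗ μ₀` and `∫_S ∫_Q g(Ψ(q, t)) dμ₀ dσ = w • ∫_Ω g dν` (change of variables along the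
measure identity, then Fubini). [cite: Federer1969, §2.10.10] [cite: HarishChandra1970, Lemma 42] -/
theorem integrable_and_integral_eq_smul_of_lintegral_radial {E : Type*} [NormedAddCommGroup E] [NormedSpace ℝ E]
    (g : G → E) (hg : IntegrableOn g Ω ν) :
    Integrable (fun p : S × Q => g (Ψ (p.2, p.1))) (σ.prod μ₀) ∧
      ∫ t, ∫ q, g (Ψ (q, t)) ∂μ₀ ∂σ = (w : ℝ) • ∫ y in Ω, g y ∂ν := by
  have hmap := map_prod_eq_smul_restrict_of_lintegral_radial hΨ h
  have hΨ' : Measurable (fun p : S × Q => Ψ (p.2, p.1)) := hΨ.comp measurable_swap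
  have hgw : Integrable g ((w : ℝ≥0∞) • ν.restrict Ω) := hg.smul_measure (ENNReal.natCast_ne_top w)
  rw [← hmap] at hgw
  have hcomp : Integrable (fun p : S × Q => g (Ψ (p.2, p.1))) (σ.prod μ₀) :=
    (integrable_map_measure hgw.aestronglyMeasurable hΨ'.aemeasurable).1 hgw
  refine ⟨hcomp, ?_⟩
  have hprod := integral_prod (fun p : S × Q => g (Ψ (p.2, p.1))) hcomp
  simp only at hprod
  rw [← hprod, ← integral_map hΨ'.aemeasurable hgw.aestronglyMeasurable, hmap, integral_smul_measure,
    ENNReal.toReal_natCast]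

end Radial

/-! ## §3 The CM carrier `U(Φ₃)(L⁺_v)`: the hyperbolic set is Borel, and the RADIAL WEYL INTEGRATION FORMULA on it -/

section CM

variable (L : Type) [Field L] [NumberField L] [IsCMField L] (v : HeightOneSpectrum (𝓞 ↥(maximalRealSubfield L)))

set_option maxHeartbeats 400000 in
-- buildfix N3 (director s1318, 2026-09-02): the declaration sits on a 160k–200k heartbeat cliff (instance-term unification at the CM carrier); budgeted, no statement change
set_option maxHeartbeats 400000 in
/-- **THE WEYL INTEGRATION FORMULA ON THE HYPERBOLIC SET OF `U(Φ₃)(L⁺_v)`, RADIAL FORM (UNCONDITIONAL).**  `v` a non-split finite place of `L⁺`,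
`G = U(Φ₃)(L⁺_v)` (matrix carrier), `T = (cmBorelTriple L 3 v).M` its split diagonal torus, `ν` a Haar measure on `G`, `tm` a Haar measure on `T`, `Φ(xT, t) = x t x⁻¹`
the conjugation family, `Ω = ⋃_g g T^{reg} g⁻¹` the hyperbolic set (★ (B1)'s shape).  There is a measure `σ` on `T`, finite on compact sets, σ-finite and CARRIED BY
`T^{reg}`, such that for every Borel `f ≥ 0` on `G`
**`2 · ∫⁻_Ω f dν = ∫⁻_T ∫⁻_{G ⧸ T} f(Φ(q, t)) d(ν∕tm)(q) dσ(t)`**, `ν∕tm` = ★ `quotientMeasure` — ★ `exists_radialMeasure_lintegral_conjFamily` with «regular set»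
`R := Ω`, every hypothesis discharged by name (see the module docstring); `2 = |N(T)∕T|` (§1).  Classically `dσ = |D_G(t)| dtm(t)`; that identification (the
Jacobian of conjugation) is NOT asserted here.  The three topological instance arguments are the ★ `locallyCompactSpace_local` ∕ `secondCountableTopology_local` ∕
`t2Space_cmDatum_local` terms at the call site. [cite: Rogawski1990, §12.5 p. 182] [cite: HarishChandra1970, Lemma 42] [cite: Weil1965, n° 49 Lemme 22 (p. 70)]
[cite: vanDijk1972, §2] -/
theorem exists_radialMeasure_lintegral_hypSet
    (hns : ∀ w : PlacesOver L v, IsCMField.complexConj L • w.1 = w.1)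
    [MeasurableSpace ↥(unitaryGroupOfForm (conjLocal L (IsCMField.complexConj L) v) (cmLocalForm L 3 v))]
    [BorelSpace ↥(unitaryGroupOfForm (conjLocal L (IsCMField.complexConj L) v) (cmLocalForm L 3 v))]
    [LocallyCompactSpace ↥(unitaryGroupOfForm (conjLocal L (IsCMField.complexConj L) v) (cmLocalForm L 3 v))]
    [SecondCountableTopology ↥(unitaryGroupOfForm (conjLocal L (IsCMField.complexConj L) v) (cmLocalForm L 3 v))]
    [T2Space ↥(unitaryGroupOfForm (conjLocal L (IsCMField.complexConj L) v) (cmLocalForm L 3 v))]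
    [MeasurableSpace (↥(unitaryGroupOfForm (conjLocal L (IsCMField.complexConj L) v) (cmLocalForm L 3 v)) ⧸ (cmBorelTriple L 3 v).M)]
    [BorelSpace (↥(unitaryGroupOfForm (conjLocal L (IsCMField.complexConj L) v) (cmLocalForm L 3 v)) ⧸ (cmBorelTriple L 3 v).M)]
    (ν : Measure ↥(unitaryGroupOfForm (conjLocal L (IsCMField.complexConj L) v) (cmLocalForm L 3 v)))
    [ν.IsHaarMeasure] [ν.IsMulRightInvariant]
    (tm : Measure ↥(cmBorelTriple L 3 v).M) [tm.IsMulLeftInvariant] [IsFiniteMeasureOnCompacts tm] [tm.IsOpenPosMeasure]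
    [tm.IsInvInvariant]
    (Φ : (↥(unitaryGroupOfForm (conjLocal L (IsCMField.complexConj L) v) (cmLocalForm L 3 v)) ⧸ (cmBorelTriple L 3 v).M) ×
        ↥(cmBorelTriple L 3 v).M → ↥(unitaryGroupOfForm (conjLocal L (IsCMField.complexConj L) v) (cmLocalForm L 3 v)))
    (hΦ : ∀ (x : ↥(unitaryGroupOfForm (conjLocal L (IsCMField.complexConj L) v) (cmLocalForm L 3 v))) (t : ↥(cmBorelTriple L 3 v).M),
      Φ (QuotientGroup.mk x, t) = x * t * x⁻¹) :
    ∃ σ : Measure ↥(cmBorelTriple L 3 v).M, IsFiniteMeasureOnCompacts σ ∧ SigmaFinite σ ∧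
      σ {t : ↥(cmBorelTriple L 3 v).M |
          ¬ IsRegularElt (((t : ↥(unitaryGroupOfForm (conjLocal L (IsCMField.complexConj L) v) (cmLocalForm L 3 v))) :
            GL (Fin 3) (LocalRing L v)))} = 0 ∧
      ∀ f : ↥(unitaryGroupOfForm (conjLocal L (IsCMField.complexConj L) v) (cmLocalForm L 3 v)) → ℝ≥0∞, Measurable f →
        2 * ∫⁻ y in {x | ∃ g t : ↥(unitaryGroupOfForm (conjLocal L (IsCMField.complexConj L) v) (cmLocalForm L 3 v)),
                t ∈ (cmBorelTriple L 3 v).M ∧ IsRegularElt (t : GL (Fin 3) (LocalRing L v)) ∧ g * t * g⁻¹ = x}, f y ∂ν =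
          ∫⁻ t, ∫⁻ q, f (Φ (q, t)) ∂(quotientMeasure (cmBorelTriple L 3 v).M tm (isClosed_cmBorelTriple_M L v) ν) ∂σ := by
  classical
  -- §a the field-like local ring at the non-split place, the split form `Φ₃`, a regular element of `T` (★ (B0))
  haveI : Nontrivial (LocalRing L v) := UnitaryGroup.nontrivial_localRing L v
  have hR : ∀ x : LocalRing L v, x ≠ 0 → IsUnit x := isUnit_of_ne_zero_of_nonsplit L v hns
  have hJ : cmLocalForm L 3 v = (StdForm.antidiagonal 3).over (LocalRing L v) := cmLocalForm_eq_over L 3 v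
  have hex := exists_mem_torusU_isRegularElt L v
  -- §b `T` is closed and abelian with Weyl group of order `2`; centralisers of regular elements of `T` are `T`
  have hT := isClosed_cmBorelTriple_M L v
  have hTc : ∀ a ∈ (cmBorelTriple L 3 v).M, ∀ b ∈ (cmBorelTriple L 3 v).M, a * b = b * a :=
    fun a ha b hb => mul_comm_of_mem_torusU_cmLocal L v ha hb
  have hW : (((cmBorelTriple L 3 v).M).subgroupOf
      (Subgroup.normalizer (((cmBorelTriple L 3 v).M : Subgroup ↥(unitaryGroupOfForm (conjLocal L (IsCMField.complexConj L) v) (cmLocalForm L 3 v))) : Set ↥(unitaryGroupOfForm (conjLocal L (IsCMField.complexConj L) v) (cmLocalForm L 3 v))))).index = 2 :=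
    index_torusU_subgroupOf_normalizer_eq_two (conjLocal L (IsCMField.complexConj L) v) hR hJ hex
  have hW0 := ne_of_eq_of_ne hW two_ne_zero
  -- §c the machinery of ★ `ConjugationFamilyFibres` ∕ `FibreCountPullback`: `Φ` continuous, locally injective on the regular part `D₀`
  haveI : PolishSpace ((↥(unitaryGroupOfForm (conjLocal L (IsCMField.complexConj L) v) (cmLocalForm L 3 v)) ⧸ (cmBorelTriple L 3 v).M) × ↥(cmBorelTriple L 3 v).M) :=
    polishSpace_quotient_prod_subgroup (cmBorelTriple L 3 v).M hT
  have hΦc : Continuous Φ := (continuous_conjFamily_and_smul (cmBorelTriple L 3 v).M Φ hΦ).1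
  haveI : SecondCountableTopology ↥(cmBorelTriple L 3 v).M := TopologicalSpace.Subtype.secondCountableTopology _
  haveI : BorelSpace ((↥(unitaryGroupOfForm (conjLocal L (IsCMField.complexConj L) v) (cmLocalForm L 3 v)) ⧸ (cmBorelTriple L 3 v).M) × ↥(cmBorelTriple L 3 v).M) := Prod.borelSpace
  have hD₀ : MeasurableSet {p : (↥(unitaryGroupOfForm (conjLocal L (IsCMField.complexConj L) v) (cmLocalForm L 3 v)) ⧸ (cmBorelTriple L 3 v).M) × ↥(cmBorelTriple L 3 v).M |
      IsRegularElt (((p.2 : ↥(unitaryGroupOfForm (conjLocal L (IsCMField.complexConj L) v) (cmLocalForm L 3 v)))) : GL (Fin 3) (LocalRing L v))} :=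
    (isOpen_setOf_isRegularElt_torusU (conjLocal L (IsCMField.complexConj L) v) (cmLocalForm L 3 v) hR).measurableSet.preimage
      measurable_snd
  have hinj : ∀ z ∈ {p : (↥(unitaryGroupOfForm (conjLocal L (IsCMField.complexConj L) v) (cmLocalForm L 3 v)) ⧸ (cmBorelTriple L 3 v).M) × ↥(cmBorelTriple L 3 v).M |
      IsRegularElt (((p.2 : ↥(unitaryGroupOfForm (conjLocal L (IsCMField.complexConj L) v) (cmLocalForm L 3 v)))) : GL (Fin 3) (LocalRing L v))},
      ∃ U : Set ((↥(unitaryGroupOfForm (conjLocal L (IsCMField.complexConj L) v) (cmLocalForm L 3 v)) ⧸ (cmBorelTriple L 3 v).M) × ↥(cmBorelTriple L 3 v).M), IsOpen U ∧ z ∈ U ∧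
        InjOn Φ (U ∩ {p | IsRegularElt (((p.2 : ↥(unitaryGroupOfForm (conjLocal L (IsCMField.complexConj L) v) (cmLocalForm L 3 v)))) : GL (Fin 3) (LocalRing L v))}) := fun z _ =>
    exists_isOpen_injOn_conjFamily (cmBorelTriple L 3 v).M hT hTc Φ hΦ
      {x : ↥(unitaryGroupOfForm (conjLocal L (IsCMField.complexConj L) v) (cmLocalForm L 3 v)) | IsRegularElt (x : GL (Fin 3) (LocalRing L v))} (fun t ht => centralizer_eq_cmTorus_of_isRegularElt L v t.2 ht) hW0 z
  -- §d the hyperbolic set is the image of `D₀`, hence Borel (Lusin–Souslin)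
  have hΩeq : Φ '' {p : (↥(unitaryGroupOfForm (conjLocal L (IsCMField.complexConj L) v) (cmLocalForm L 3 v)) ⧸ (cmBorelTriple L 3 v).M) × ↥(cmBorelTriple L 3 v).M |
      IsRegularElt (((p.2 : ↥(unitaryGroupOfForm (conjLocal L (IsCMField.complexConj L) v) (cmLocalForm L 3 v)))) : GL (Fin 3) (LocalRing L v))} =
      {x | ∃ g t : ↥(unitaryGroupOfForm (conjLocal L (IsCMField.complexConj L) v) (cmLocalForm L 3 v)), t ∈ (cmBorelTriple L 3 v).M ∧ IsRegularElt (t : GL (Fin 3) (LocalRing L v)) ∧ g * t * g⁻¹ = x} := by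
    ext x
    constructor
    · rintro ⟨⟨q, t⟩, ht, rfl⟩
      obtain ⟨g, rfl⟩ := QuotientGroup.mk_surjective q
      exact ⟨g, t, t.2, ht, (hΦ g t).symm⟩
    · rintro ⟨g, t, htT, ht, rfl⟩
      exact ⟨(QuotientGroup.mk g, ⟨t, htT⟩), ht, hΦ g ⟨t, htT⟩⟩
  have hΩm : MeasurableSet
      {x | ∃ g t : ↥(unitaryGroupOfForm (conjLocal L (IsCMField.complexConj L) v) (cmLocalForm L 3 v)), t ∈ (cmBorelTriple L 3 v).M ∧ IsRegularElt (t : GL (Fin 3) (LocalRing L v)) ∧ g * t * g⁻¹ = x} := by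
    rw [← hΩeq, ← Set.univ_inter {p : (↥(unitaryGroupOfForm (conjLocal L (IsCMField.complexConj L) v) (cmLocalForm L 3 v)) ⧸ (cmBorelTriple L 3 v).M) × ↥(cmBorelTriple L 3 v).M |
      IsRegularElt (((p.2 : ↥(unitaryGroupOfForm (conjLocal L (IsCMField.complexConj L) v) (cmLocalForm L 3 v)))) : GL (Fin 3) (LocalRing L v))}]
    exact measurableSet_image_inter_of_locallyInjOn hD₀ hΦc hinj MeasurableSet.univ
  -- §e ★ `exists_radialMeasure_lintegral_conjFamily` with «regular set» `R := Ω`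
  have hRTΩ : ∀ t : ↥(cmBorelTriple L 3 v).M,
      (t : ↥(unitaryGroupOfForm (conjLocal L (IsCMField.complexConj L) v) (cmLocalForm L 3 v))) ∈ {x | ∃ g t : ↥(unitaryGroupOfForm (conjLocal L (IsCMField.complexConj L) v) (cmLocalForm L 3 v)), t ∈ (cmBorelTriple L 3 v).M ∧ IsRegularElt (t : GL (Fin 3) (LocalRing L v)) ∧ g * t * g⁻¹ = x} →
      Subgroup.centralizer ({(t : ↥(unitaryGroupOfForm (conjLocal L (IsCMField.complexConj L) v) (cmLocalForm L 3 v)))} : Set ↥(unitaryGroupOfForm (conjLocal L (IsCMField.complexConj L) v) (cmLocalForm L 3 v))) = (cmBorelTriple L 3 v).M := fun t ht =>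
    centralizer_eq_cmTorus_of_isRegularElt L v t.2
      (isRegularElt_of_mem_hypSet (conjLocal L (IsCMField.complexConj L) v) (cmLocalForm L 3 v) ht)
  have hRcΩ : ∀ g x : ↥(unitaryGroupOfForm (conjLocal L (IsCMField.complexConj L) v) (cmLocalForm L 3 v)),
      x ∈ {x | ∃ g t : ↥(unitaryGroupOfForm (conjLocal L (IsCMField.complexConj L) v) (cmLocalForm L 3 v)), t ∈ (cmBorelTriple L 3 v).M ∧ IsRegularElt (t : GL (Fin 3) (LocalRing L v)) ∧ g * t * g⁻¹ = x} →
      g * x * g⁻¹ ∈ {x | ∃ g t : ↥(unitaryGroupOfForm (conjLocal L (IsCMField.complexConj L) v) (cmLocalForm L 3 v)), t ∈ (cmBorelTriple L 3 v).M ∧ IsRegularElt (t : GL (Fin 3) (LocalRing L v)) ∧ g * t * g⁻¹ = x} :=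
    fun g x hx => conj_mem_hypSet (conjLocal L (IsCMField.complexConj L) v) (cmLocalForm L 3 v) hx g
  obtain ⟨σ', hfin, hsf, hcar, hmain⟩ :=
    exists_radialMeasure_lintegral_conjFamily (cmBorelTriple L 3 v).M hT hTc ν Φ hΦ _ hΩm hRTΩ hRcΩ hW0 tm
  have hDΩ : {p : (↥(unitaryGroupOfForm (conjLocal L (IsCMField.complexConj L) v) (cmLocalForm L 3 v)) ⧸ (cmBorelTriple L 3 v).M) × ↥(cmBorelTriple L 3 v).M | ((p.2 : ↥(cmBorelTriple L 3 v).M) : ↥(unitaryGroupOfForm (conjLocal L (IsCMField.complexConj L) v) (cmLocalForm L 3 v))) ∈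
      {x | ∃ g t : ↥(unitaryGroupOfForm (conjLocal L (IsCMField.complexConj L) v) (cmLocalForm L 3 v)), t ∈ (cmBorelTriple L 3 v).M ∧ IsRegularElt (t : GL (Fin 3) (LocalRing L v)) ∧ g * t * g⁻¹ = x}} =
      {p | IsRegularElt (((p.2 : ↥(unitaryGroupOfForm (conjLocal L (IsCMField.complexConj L) v) (cmLocalForm L 3 v)))) : GL (Fin 3) (LocalRing L v))} := by
    ext p
    exact ⟨fun h => isRegularElt_of_mem_hypSet (conjLocal L (IsCMField.complexConj L) v) (cmLocalForm L 3 v) h,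
      fun h => mem_hypSet_of_mem_torusU (conjLocal L (IsCMField.complexConj L) v) (cmLocalForm L 3 v) p.2.2 h⟩
  refine ⟨σ', hfin, hsf, ?_, fun f hf => ?_⟩
  · rw [← hcar]
    congr 1
    ext t
    simp only [mem_setOf_eq]
    exact not_congr ⟨fun h => mem_hypSet_of_mem_torusU (conjLocal L (IsCMField.complexConj L) v) (cmLocalForm L 3 v) t.2 h,
      fun h => isRegularElt_of_mem_hypSet (conjLocal L (IsCMField.complexConj L) v) (cmLocalForm L 3 v) h⟩
  · have h := hmain f hf
    rw [hW, hDΩ, hΩeq] at h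
    simpa only [Nat.cast_ofNat] using h

set_option maxHeartbeats 400000 in
-- buildfix N3: same cliff (calls the previous declaration and re-elaborates the `quotientMeasure` instance terms)
/-- **THE WEYL INTEGRATION FORMULA ON THE HYPERBOLIC SET — measure and Bochner forms** (same `σ` as `exists_radialMeasure_lintegral_hypSet`): in addition to the
`∫⁻` identity, `(σ ⊗ (ν∕tm)) ∘ Φ̃⁻¹ = 2 · ν|_Ω` as measures on `G` (`Φ̃(t, q) = Φ(q, t)`), and for every `g : G → ℂ` that is `ν`-integrable on `Ω` the integrand
`(t, q) ↦ g(Φ(q, t))` is `σ ⊗ (ν∕tm)`-integrable with **`∫_T ∫_{G ⧸ T} g(Φ(q, t)) d(ν∕tm) dσ = 2 • ∫_Ω g dν`** — i.e. `∫_Ω g = ½ ∫_T (∫_{G⧸T} g(x t x⁻¹) dẋ) dσ(t)`,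
the shape the (PSM★)∕(WM)∕(HM) road integrates against van Dijk's torus form. [cite: Rogawski1990, §12.5 p. 182] [cite: HarishChandra1970, Lemma 42]
[cite: vanDijk1972, §2] -/
theorem exists_radialMeasure_integral_hypSet
    (hns : ∀ w : PlacesOver L v, IsCMField.complexConj L • w.1 = w.1)
    [MeasurableSpace ↥(unitaryGroupOfForm (conjLocal L (IsCMField.complexConj L) v) (cmLocalForm L 3 v))]
    [BorelSpace ↥(unitaryGroupOfForm (conjLocal L (IsCMField.complexConj L) v) (cmLocalForm L 3 v))]
    [LocallyCompactSpace ↥(unitaryGroupOfForm (conjLocal L (IsCMField.complexConj L) v) (cmLocalForm L 3 v))]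
    [SecondCountableTopology ↥(unitaryGroupOfForm (conjLocal L (IsCMField.complexConj L) v) (cmLocalForm L 3 v))]
    [T2Space ↥(unitaryGroupOfForm (conjLocal L (IsCMField.complexConj L) v) (cmLocalForm L 3 v))]
    [MeasurableSpace (↥(unitaryGroupOfForm (conjLocal L (IsCMField.complexConj L) v) (cmLocalForm L 3 v)) ⧸ (cmBorelTriple L 3 v).M)]
    [BorelSpace (↥(unitaryGroupOfForm (conjLocal L (IsCMField.complexConj L) v) (cmLocalForm L 3 v)) ⧸ (cmBorelTriple L 3 v).M)]
    (ν : Measure ↥(unitaryGroupOfForm (conjLocal L (IsCMField.complexConj L) v) (cmLocalForm L 3 v)))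
    [ν.IsHaarMeasure] [ν.IsMulRightInvariant]
    (tm : Measure ↥(cmBorelTriple L 3 v).M) [tm.IsMulLeftInvariant] [IsFiniteMeasureOnCompacts tm] [tm.IsOpenPosMeasure]
    [tm.IsInvInvariant]
    (Φ : (↥(unitaryGroupOfForm (conjLocal L (IsCMField.complexConj L) v) (cmLocalForm L 3 v)) ⧸ (cmBorelTriple L 3 v).M) × ↥(cmBorelTriple L 3 v).M → ↥(unitaryGroupOfForm (conjLocal L (IsCMField.complexConj L) v) (cmLocalForm L 3 v)))
    (hΦ : ∀ (x : ↥(unitaryGroupOfForm (conjLocal L (IsCMField.complexConj L) v) (cmLocalForm L 3 v))) (t : ↥(cmBorelTriple L 3 v).M), Φ (QuotientGroup.mk x, t) = x * t * x⁻¹) :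
    ∃ σ : Measure ↥(cmBorelTriple L 3 v).M, IsFiniteMeasureOnCompacts σ ∧ SigmaFinite σ ∧
      σ {t : ↥(cmBorelTriple L 3 v).M | ¬ IsRegularElt (((t : ↥(unitaryGroupOfForm (conjLocal L (IsCMField.complexConj L) v) (cmLocalForm L 3 v)))) : GL (Fin 3) (LocalRing L v))} = 0 ∧
      (∀ f : ↥(unitaryGroupOfForm (conjLocal L (IsCMField.complexConj L) v) (cmLocalForm L 3 v)) → ℝ≥0∞, Measurable f →
        2 * ∫⁻ y in {x | ∃ g t : ↥(unitaryGroupOfForm (conjLocal L (IsCMField.complexConj L) v) (cmLocalForm L 3 v)), t ∈ (cmBorelTriple L 3 v).M ∧ IsRegularElt (t : GL (Fin 3) (LocalRing L v)) ∧ g * t * g⁻¹ = x}, f y ∂ν =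
          ∫⁻ t, ∫⁻ q, f (Φ (q, t)) ∂(quotientMeasure (cmBorelTriple L 3 v).M tm (isClosed_cmBorelTriple_M L v) ν) ∂σ) ∧
      (σ.prod (quotientMeasure (cmBorelTriple L 3 v).M tm (isClosed_cmBorelTriple_M L v) ν)).map (fun p => Φ (p.2, p.1)) =
        (2 : ℝ≥0∞) • ν.restrict {x | ∃ g t : ↥(unitaryGroupOfForm (conjLocal L (IsCMField.complexConj L) v) (cmLocalForm L 3 v)), t ∈ (cmBorelTriple L 3 v).M ∧ IsRegularElt (t : GL (Fin 3) (LocalRing L v)) ∧ g * t * g⁻¹ = x} ∧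
      ∀ g : ↥(unitaryGroupOfForm (conjLocal L (IsCMField.complexConj L) v) (cmLocalForm L 3 v)) → ℂ,
        IntegrableOn g {x | ∃ g t : ↥(unitaryGroupOfForm (conjLocal L (IsCMField.complexConj L) v) (cmLocalForm L 3 v)), t ∈ (cmBorelTriple L 3 v).M ∧ IsRegularElt (t : GL (Fin 3) (LocalRing L v)) ∧ g * t * g⁻¹ = x} ν →
        Integrable (fun p : ↥(cmBorelTriple L 3 v).M × (↥(unitaryGroupOfForm (conjLocal L (IsCMField.complexConj L) v) (cmLocalForm L 3 v)) ⧸ (cmBorelTriple L 3 v).M) => g (Φ (p.2, p.1)))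
            (σ.prod (quotientMeasure (cmBorelTriple L 3 v).M tm (isClosed_cmBorelTriple_M L v) ν)) ∧
          ∫ t, ∫ q, g (Φ (q, t)) ∂(quotientMeasure (cmBorelTriple L 3 v).M tm (isClosed_cmBorelTriple_M L v) ν) ∂σ =
            (2 : ℝ) • ∫ y in {x | ∃ g t : ↥(unitaryGroupOfForm (conjLocal L (IsCMField.complexConj L) v) (cmLocalForm L 3 v)), t ∈ (cmBorelTriple L 3 v).M ∧ IsRegularElt (t : GL (Fin 3) (LocalRing L v)) ∧ g * t * g⁻¹ = x}, g y ∂ν := by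
  obtain ⟨σ', hfin, hsf, hcar, hmain⟩ := exists_radialMeasure_lintegral_hypSet L v hns ν tm Φ hΦ
  haveI := hsf
  haveI : SecondCountableTopology (↥(unitaryGroupOfForm (conjLocal L (IsCMField.complexConj L) v) (cmLocalForm L 3 v)) ⧸ (cmBorelTriple L 3 v).M) :=
    (QuotientGroup.isQuotientMap_mk _).secondCountableTopology QuotientGroup.isOpenMap_coe
  haveI : LocallyCompactSpace (↥(unitaryGroupOfForm (conjLocal L (IsCMField.complexConj L) v) (cmLocalForm L 3 v)) ⧸ (cmBorelTriple L 3 v).M) := QuotientGroup.instLocallyCompactSpace _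
  haveI : SigmaCompactSpace (↥(unitaryGroupOfForm (conjLocal L (IsCMField.complexConj L) v) (cmLocalForm L 3 v)) ⧸ (cmBorelTriple L 3 v).M) := sigmaCompactSpace_of_locallyCompact_secondCountable
  haveI : SigmaFinite (quotientMeasure (cmBorelTriple L 3 v).M tm (isClosed_cmBorelTriple_M L v) ν) :=
    SigmaFinite.of_isFiniteMeasureOnCompacts _
  haveI : SecondCountableTopology ↥(cmBorelTriple L 3 v).M := TopologicalSpace.Subtype.secondCountableTopology _
  haveI : BorelSpace ((↥(unitaryGroupOfForm (conjLocal L (IsCMField.complexConj L) v) (cmLocalForm L 3 v)) ⧸ (cmBorelTriple L 3 v).M) × ↥(cmBorelTriple L 3 v).M) := Prod.borelSpace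
  have hΦm : Measurable Φ := (continuous_conjFamily_and_smul (cmBorelTriple L 3 v).M Φ hΦ).1.measurable
  have hmain' : ∀ f : ↥(unitaryGroupOfForm (conjLocal L (IsCMField.complexConj L) v) (cmLocalForm L 3 v)) → ℝ≥0∞, Measurable f →
      ((2 : ℕ) : ℝ≥0∞) * ∫⁻ y in {x | ∃ g t : ↥(unitaryGroupOfForm (conjLocal L (IsCMField.complexConj L) v) (cmLocalForm L 3 v)), t ∈ (cmBorelTriple L 3 v).M ∧ IsRegularElt (t : GL (Fin 3) (LocalRing L v)) ∧ g * t * g⁻¹ = x}, f y ∂ν =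
        ∫⁻ t, ∫⁻ q, f (Φ (q, t)) ∂(quotientMeasure (cmBorelTriple L 3 v).M tm (isClosed_cmBorelTriple_M L v) ν) ∂σ' :=
    fun f hf => by rw [Nat.cast_ofNat]; exact hmain f hf
  refine ⟨σ', hfin, hsf, hcar, hmain, ?_, fun g hg => ?_⟩
  · simpa only [Nat.cast_ofNat] using map_prod_eq_smul_restrict_of_lintegral_radial hΦm hmain'
  · simpa only [Nat.cast_ofNat] using integrable_and_integral_eq_smul_of_lintegral_radial hΦm hmain' g hg

end CM

end Summit.HodgeConjecture.HodgeConjecture.Cruxes.H413.F0P3cStCharTSWeylHypMeasure
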